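import Summits.ResolutionOfSingularities.ResolutionOfSingularities.Theorems.HomologicalConductorNoZenoFiniteCentreBlowup
import Literature.AlgebraicGeometry.Resolution.BirationalDimensionInequality
import Literature.AlgebraicGeometry.Resolution.FiniteBirationalNormal
import HarnessLib

/-!
# Crux `NoZenoR` (stmt-ResolutionOfSingularities-19943), slot 5 closer glue: the local rings of a resolution of a two-dimensional germ at the
# points strictly below an exceptional curve have dimension EXACTLY two

OURS (cell res-hironaka, crux chain W4.4, lead res-L0-w44-lead-1 g9); AI-written, weaker than expert review; nothing here is a statement
of the manuscript under review (Hironaka 2017).  Def-free, fact-free, `--supports 19943 --as helper`.  Supplies the binder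
`hNdim : ∀ z ∈ Nc, ringKrullDim 𝒪_{X,z} = 2` of `hasSplitExcCurveCountLE_pred_of_finiteCentre` (p576042): `≥ 2` is o5's
`FiniteCentreBlowup.two_le_ringKrullDim_stalk`; `≤ 2` is the birational dimension inequality
(`ringKrullDim_stalk_le_of_isIso_stalkMap_genericPoint`, Matsumura 15.5) at `z` over the closed point, whose local ring on `Spec S` is `S`.

References: H. Matsumura, *Commutative Ring Theory* (1986), Thm. 15.5 [`Matsumura1987`].
-/

noncomputable section

-- single-problem summit: the doubled namespace component `ResolutionOfSingularities` is forced
set_option linter.dupNamespace false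

namespace Summit.ResolutionOfSingularities.ResolutionOfSingularities.Theorems.NoZeno.ExcCount

open CategoryTheory AlgebraicGeometry TopologicalSpace IsLocalRing
open Literature.AlgebraicGeometry.Resolution

/-- The local ring of `Spec S` at the closed point of the local ring `S` is `S`: same Krull dimension. [folklore] -/
theorem ringKrullDim_stalk_closedPoint (S : Type) [CommRing S] [IsLocalRing S] :
    ringKrullDim ((Spec (.of S)).presheaf.stalk (closedPoint S)) = ringKrullDim S := by
  letI : Algebra S ((Spec (.of S)).presheaf.stalk (closedPoint S)) := StructureSheaf.stalkAlgebra S (closedPoint S)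
  haveI : IsLocalization.AtPrime ((Spec (.of S)).presheaf.stalk (closedPoint S)) (maximalIdeal S) :=
    StructureSheaf.IsLocalization.to_stalk S (closedPoint S)
  have hunits : (maximalIdeal S).primeCompl ≤ IsUnit.submonoid S := fun s hs => by
    by_contra h
    exact hs h
  let e : S ≃ₐ[S] (Spec (.of S)).presheaf.stalk (closedPoint S) :=
    IsLocalization.atUnits S (maximalIdeal S).primeCompl hunits
  exact (ringKrullDim_eq_of_ringEquiv e.toRingEquiv).symm

/-- **Dimension two at the points strictly below an exceptional curve.**  For a resolution `π : X → Spec S` of the two-dimensional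
Noetherian local domain `S` and a point `z` strictly specialised from an integral exceptional curve: `ringKrullDim 𝒪_{X,z} = 2`.
[cite: Matsumura1987, Thm. 15.5] -/
theorem ringKrullDim_stalk_eq_two_of_specializes {S : Type} [CommRing S] [IsNoetherianRing S] [IsLocalRing S] [IsDomain S]
    (h2 : ringKrullDim S = 2) {X : Scheme.{0}} (π : X ⟶ Spec (.of S)) (hπ : IsResolution π) {z : X}
    (hz : ∃ η ∈ excCurvePoints π, η ⤳ z ∧ z ≠ η) : ringKrullDim (X.presheaf.stalk z) = 2 := by
  haveI : IsIntegral X := hπ.isIntegral_source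
  haveI : IsProper π := hπ.isProper
  haveI : IsDominant π := hπ.isBirational.isDominant
  apply le_antisymm
  · -- the birational dimension inequality at `z`, which lies over the closed point
    obtain ⟨η, hη, hηz, -⟩ := hz
    have hπz : π.base z = closedPoint S := base_eq_closedPoint_of_specializes π hη.1 hηz
    have hle := ringKrullDim_stalk_le_of_isIso_stalkMap_genericPoint π hπ.isBirational.isIso_stalkMap_genericPoint z
    rw [show π z = closedPoint S from hπz, ringKrullDim_stalk_closedPoint S, h2] at hle
    exact hle
  · exact FiniteCentreBlowup.two_le_ringKrullDim_stalk π (N := {z}) (fun w hw => by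
      rw [Set.mem_singleton_iff.mp hw]; exact hz) h2 hπ (Set.mem_singleton z)

end Summit.ResolutionOfSingularities.ResolutionOfSingularities.Theorems.NoZeno.ExcCount

end
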